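import Mathlib
import Summits.Ventures.PercRepro2.LocRows
import Summits.Ventures.PercRepro2.SwRow
import Summits.Ventures.PercRepro2.SwOut
import Summits.Ventures.PercRepro2.SwAllRow
import Summits.Ventures.PercRepro2.SwOutAll

/-!
# The edge `h–u` by subdivision with an outside edge: the graph `G⁺` and the transport of the
class (blind cell PercRepro2, night-4 g29, 2026-08-28; proofs/NIGHT4-G29.md §1)

A junction `u` joined to `h` by ONE edge `e₀` is outside g14's Theorem A (`hnadj`).  `G⁺`
subdivides `e₀` by a new vertex `w` (`h–w` is the old edge `e₀`, `w–u` the new edge `inr false`) and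
adds the outside edge `w–l` (`inr true`): in `G⁺` the junction `u` is not adjacent to `h` and `w`
carries an outside edge, so Theorem A applies to `G⁺` verbatim.  A configuration `ζ` of `G` LIFTS
to the UNIFORM configuration `ulift ζ` of `G⁺` (`h–w` and `w–u` coloured like `e₀`, `w–l` the other
colour).  This file: `subdEnds`, `subdRegion`, `subdLift` / `ulift`, the push / pull of edge sets
(`e₀ ↦ {h–w, w–u}`: `subdPush`, `subdPull`) and the CLUSTER TRANSPORT — the red cluster of a vertex
`x` of `G` in `G⁺` is its cluster in `G` together with `w` exactly when `e₀` is red and `h` is in the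
cluster, or the third edge is red and `l` is in the cluster (`some_mem_cluster_subdLift_iff`,
`none_mem_cluster_subdLift_iff`).  The next file (`SwOutJunctionH1EdgeLift`) transports the hull,
the class, the side `Q` and the rigid edge sets of the uniform lift.
-/

namespace Summit.Ventures.PercRepro2

namespace LocRows

open Hull

variable {V : Type*} {E : Type*}

/-! ## The lifts, the region, push and pull (no decidability needed) -/

section Lift

variable (e₀ : E)

/-- The region `U⁺ = U ∪ {w}`. -/
def subdRegion (U : Set V) : Set (Option V) := {x | ∀ v, x = some v → v ∈ U}

/-- The lift of a configuration with a prescribed colour `d` on `w–l`: `h–w` and `w–u` take the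
colour of `e₀`. -/
def subdLift (ζ : Config E) (d : Bool) : Config (E ⊕ Bool)
  | Sum.inl e => ζ e
  | Sum.inr false => ζ e₀
  | Sum.inr true => d

/-- The uniform lift: `w–l` takes the colour opposite to `e₀`. -/
def ulift (ζ : Config E) : Config (E ⊕ Bool) := subdLift e₀ ζ (!ζ e₀)

/-- The push of an edge set of `G` to `G⁺`: `e₀` goes to `{h–w, w–u}`. -/
def subdPush (F : Set E) : Set (E ⊕ Bool) :=
  {e | (∃ e' ∈ F, e = Sum.inl e') ∨ (e₀ ∈ F ∧ e = Sum.inr false)}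

/-- The pull of an edge set of `G⁺` to `G`: `e₀` is in it when both `h–w` and `w–u` are. -/
def subdPull (F : Set (E ⊕ Bool)) : Set E :=
  {e | Sum.inl e ∈ F ∧ (e = e₀ → Sum.inr false ∈ F)}

variable {e₀}

/-- The lift on the copy of an edge of `G`. -/
@[simp] lemma subdLift_inl (ζ : Config E) (d : Bool) (e : E) : subdLift e₀ ζ d (Sum.inl e) = ζ e := rfl

/-- The lift on `w–u`: the colour of `e₀`. -/
@[simp] lemma subdLift_inr_false (ζ : Config E) (d : Bool) :
    subdLift e₀ ζ d (Sum.inr false) = ζ e₀ := rfl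

/-- The lift on `w–l`: the prescribed colour. -/
@[simp] lemma subdLift_inr_true (ζ : Config E) (d : Bool) : subdLift e₀ ζ d (Sum.inr true) = d := rfl

/-- The uniform lift on the copy of an edge of `G`. -/
@[simp] lemma ulift_inl (ζ : Config E) (e : E) : ulift e₀ ζ (Sum.inl e) = ζ e := rfl

/-- The uniform lift on `w–u`: the colour of `e₀`. -/
@[simp] lemma ulift_inr_false (ζ : Config E) : ulift e₀ ζ (Sum.inr false) = ζ e₀ := rfl

/-- The uniform lift on `w–l`: the colour opposite to `e₀`. -/
@[simp] lemma ulift_inr_true (ζ : Config E) : ulift e₀ ζ (Sum.inr true) = !ζ e₀ := rfl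

/-- The colour swap commutes with the lift (the third edge swapped too). -/
lemma blue_subdLift (ζ : Config E) (d : Bool) :
    blue (subdLift e₀ ζ d) = subdLift e₀ (blue ζ) (!d) := by
  funext e
  rcases e with e | b
  · rfl
  · cases b <;> rfl

/-- The colour swap commutes with the uniform lift. -/
lemma blue_ulift (ζ : Config E) : blue (ulift e₀ ζ) = ulift e₀ (blue ζ) := by
  funext e
  rcases e with e | b
  · rfl
  · cases b
    · rfl
    · simp [ulift, subdLift, blue]

/-- The uniform lift is injective. -/
lemma ulift_injective : Function.Injective (ulift e₀ : Config E → Config (E ⊕ Bool)) := by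
  intro ζ ζ' hζ
  funext e
  have := congrFun hζ (Sum.inl e)
  simpa using this

/-- A vertex of `G` lies in `U⁺` iff it lies in `U`. -/
@[simp] lemma some_mem_subdRegion_iff {U : Set V} {v : V} : some v ∈ subdRegion U ↔ v ∈ U := by
  simp [subdRegion]

/-- `w` lies in `U⁺`. -/
@[simp] lemma none_mem_subdRegion {U : Set V} : (none : Option V) ∈ subdRegion U := by
  simp [subdRegion]

/-- Every element of `Sym2` is a pair. -/
lemma exists_pair_eq (z : Sym2 V) : ∃ p q : V, z = s(p, q) :=
  Sym2.ind (fun p q => ⟨p, q, rfl⟩) z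

/-- The copy of an edge of `G` is in the push iff the edge is in the set. -/
lemma mem_subdPush_inl_iff {F : Set E} {e : E} : Sum.inl e ∈ subdPush e₀ F ↔ e ∈ F := by
  simp only [subdPush, Set.mem_setOf_eq, Sum.inl.injEq, reduceCtorEq, and_false, or_false]
  constructor
  · rintro ⟨e', he', rfl⟩
    exact he'
  · intro he
    exact ⟨e, he, rfl⟩

/-- The edge `w–u` is in the push iff `e₀` is in the set. -/
lemma mem_subdPush_inr_false_iff {F : Set E} : Sum.inr false ∈ subdPush e₀ F ↔ e₀ ∈ F := by
  simp [subdPush]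

/-- The edge `w–l` is never in a push. -/
lemma not_mem_subdPush_inr_true {F : Set E} : Sum.inr true ∉ subdPush e₀ F := by
  simp [subdPush]

/-- Pulling back a pushed edge set gives it back. -/
lemma subdPull_subdPush (F : Set E) : subdPull e₀ (subdPush e₀ F) = F := by
  ext e
  simp only [subdPull, Set.mem_setOf_eq, mem_subdPush_inl_iff, mem_subdPush_inr_false_iff]
  constructor
  · exact fun h' => h'.1
  · exact fun he => ⟨he, fun hee => hee ▸ he⟩

/-- The pull is monotone. -/
lemma subdPull_mono {F F' : Set (E ⊕ Bool)} (hFF' : F ⊆ F') : subdPull e₀ F ⊆ subdPull e₀ F' :=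
  fun _ ⟨h1, h2⟩ => ⟨hFF' h1, fun hee => hFF' (h2 hee)⟩

/-- The preimage of an up-set of `2^E` under the pull is an up-set of `2^{E⁺}`. -/
lemma isUpperSet_subdPull_preimage {𝓔 : Set (Set E)} (h𝓔 : IsUpperSet 𝓔) :
    IsUpperSet {F : Set (E ⊕ Bool) | subdPull e₀ F ∈ 𝓔} :=
  fun _ _ hFF' hF => h𝓔 (subdPull_mono hFF') hF

end Lift

/-! ## The subdivided graph -/

section Subd

variable [DecidableEq E] (ends : E → Sym2 V) (e₀ : E) (h u l : V)

/-- The subdivided graph `G⁺` on `Option V` (the new vertex `w = none`) and `E ⊕ Bool`: the edge `e₀`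
becomes `h–w`, `inr false` is `w–u`, `inr true` is `w–l`; every other edge keeps its ends. -/
def subdEnds : E ⊕ Bool → Sym2 (Option V)
  | Sum.inl e => if e = e₀ then s(some h, none) else (ends e).map some
  | Sum.inr false => s(none, some u)
  | Sum.inr true => s(none, some l)

variable {ends e₀ h u l}

/-- The edge `e₀` of `G⁺` is `h–w`. -/
@[simp] lemma subdEnds_inl_self : subdEnds ends e₀ h u l (Sum.inl e₀) = s(some h, none) := by
  simp [subdEnds]

/-- Every other edge of `G` keeps its ends in `G⁺`. -/
lemma subdEnds_inl_of_ne {e : E} (he : e ≠ e₀) :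
    subdEnds ends e₀ h u l (Sum.inl e) = (ends e).map some := by
  simp [subdEnds, he]

/-- The edge `inr false` of `G⁺` is `w–u`. -/
@[simp] lemma subdEnds_inr_false : subdEnds ends e₀ h u l (Sum.inr false) = s(none, some u) := rfl

/-- The edge `inr true` of `G⁺` is `w–l`. -/
@[simp] lemma subdEnds_inr_true : subdEnds ends e₀ h u l (Sum.inr true) = s(none, some l) := rfl

/-- A loop at `p` in `G` is a loop at `some p` in `G⁺` — contrapositive form used below. -/
lemma subdEnds_inl_ne_of_ne {e : E} {p q : V} (he : e ≠ e₀) (hpq : ends e ≠ s(p, q)) :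
    subdEnds ends e₀ h u l (Sum.inl e) ≠ s(some p, some q) := by
  rw [subdEnds_inl_of_ne he]
  intro hmap
  obtain ⟨a, b, hab⟩ := exists_pair_eq (ends e)
  rw [hab, Sym2.map_mk, Sym2.eq_iff] at hmap
  apply hpq
  rw [hab, Sym2.eq_iff]
  rcases hmap with ⟨h1, h2⟩ | ⟨h1, h2⟩
  · exact Or.inl ⟨Option.some_injective _ h1, Option.some_injective _ h2⟩
  · exact Or.inr ⟨Option.some_injective _ h1, Option.some_injective _ h2⟩

end Subd

/-! ## The cluster transport -/

section Cluster

variable [DecidableEq E] {ends : E → Sym2 V} {e₀ : E} {h u l : V} {ζ : Config E} {d : Bool}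

/-- `w` joins the cluster of `x`: through `h–w` when `e₀` is red and `h` is in the cluster, or through
`w–l` when that edge is red and `l` is in the cluster. -/
def subdWIn (ends : E → Sym2 V) (e₀ : E) (h l : V) (ζ : Config E) (d : Bool) (x : V) : Prop :=
  (ζ e₀ = true ∧ h ∈ cluster ends ζ x) ∨ (d = true ∧ l ∈ cluster ends ζ x)

variable (he₀ : ends e₀ = s(h, u)) (hd : d = true → ζ e₀ = false)
include he₀ hd

/-- **The cluster transport, one direction**: the cluster of `some x` in `G⁺` lies in the image of
the cluster of `x`, with `w` only under `subdWIn`. -/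
lemma cluster_subdLift_subset (x : V) :
    cluster (subdEnds ends e₀ h u l) (subdLift e₀ ζ d) (some x) ⊆
      {y | (∃ v ∈ cluster ends ζ x, y = some v) ∨ (y = none ∧ subdWIn ends e₀ h l ζ d x)} := by
  intro y hy
  refine mem_of_conn_of_closed (ends := subdEnds ends e₀ h u l) (ω := subdLift e₀ ζ d) ?_
    (Or.inl ⟨x, mem_cluster_self _ _ _, rfl⟩) hy
  intro a ha b hab
  obtain ⟨_, e, he, hends⟩ := openGraph_adj.1 hab
  rcases e with e | c
  · by_cases hee : e = e₀
    · subst hee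
      rw [subdEnds_inl_self, Sym2.eq_iff] at hends
      have hred : ζ e = true := he
      rcases hends with ⟨rfl, rfl⟩ | ⟨rfl, rfl⟩
      · -- `a = some h`, `b = w`
        rcases ha with ⟨v, hv, hva⟩ | ⟨hnone, _⟩
        · have hvh : v = h := Option.some_injective _ hva.symm
          subst hvh
          exact Or.inr ⟨rfl, Or.inl ⟨hred, hv⟩⟩
        · exact absurd hnone (by simp)
      · -- `a = w`, `b = some h`
        rcases ha with ⟨v, _, hva⟩ | ⟨_, hw⟩
        · exact absurd hva (by simp)
        · rcases hw with ⟨_, hh⟩ | ⟨hdt, _⟩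
          · exact Or.inl ⟨h, hh, rfl⟩
          · exact absurd hred (by rw [hd hdt]; decide)
    · rw [subdEnds_inl_of_ne hee] at hends
      obtain ⟨p, q, hpq⟩ := exists_pair_eq (ends e)
      rw [hpq, Sym2.map_mk, Sym2.eq_iff] at hends
      have hred : ζ e = true := he
      rcases hends with ⟨rfl, rfl⟩ | ⟨rfl, rfl⟩
      · rcases ha with ⟨v, hv, hva⟩ | ⟨hnone, _⟩
        · have hvp : v = p := Option.some_injective _ hva.symm
          subst hvp
          exact Or.inl ⟨q, mem_cluster_of_edge hv hred hpq, rfl⟩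
        · exact absurd hnone (by simp)
      · rcases ha with ⟨v, hv, hva⟩ | ⟨hnone, _⟩
        · have hvq : v = q := Option.some_injective _ hva.symm
          subst hvq
          exact Or.inl ⟨p, mem_cluster_of_edge hv hred (ends_swap hpq), rfl⟩
        · exact absurd hnone (by simp)
  · cases c
    · -- the edge `w–u`
      rw [subdEnds_inr_false, Sym2.eq_iff] at hends
      have hred : ζ e₀ = true := he
      rcases hends with ⟨rfl, rfl⟩ | ⟨rfl, rfl⟩
      · rcases ha with ⟨v, _, hva⟩ | ⟨_, hw⟩
        · exact absurd hva (by simp)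
        · rcases hw with ⟨_, hh⟩ | ⟨hdt, _⟩
          · exact Or.inl ⟨u, mem_cluster_of_edge hh hred he₀, rfl⟩
          · exact absurd hred (by rw [hd hdt]; decide)
      · rcases ha with ⟨v, hv, hva⟩ | ⟨hnone, _⟩
        · have hvu : v = u := Option.some_injective _ hva.symm
          subst hvu
          exact Or.inr ⟨rfl, Or.inl ⟨hred, mem_cluster_of_edge hv hred (ends_swap he₀)⟩⟩
        · exact absurd hnone (by simp)
    · -- the edge `w–l`
      rw [subdEnds_inr_true, Sym2.eq_iff] at hends
      have hdt : d = true := he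
      rcases hends with ⟨rfl, rfl⟩ | ⟨rfl, rfl⟩
      · rcases ha with ⟨v, _, hva⟩ | ⟨_, hw⟩
        · exact absurd hva (by simp)
        · rcases hw with ⟨hred, _⟩ | ⟨_, hl⟩
          · exact absurd hred (by rw [hd hdt]; decide)
          · exact Or.inl ⟨l, hl, rfl⟩
      · rcases ha with ⟨v, hv, hva⟩ | ⟨hnone, _⟩
        · have hvl : v = l := Option.some_injective _ hva.symm
          subst hvl
          exact Or.inr ⟨rfl, Or.inr ⟨hdt, hv⟩⟩
        · exact absurd hnone (by simp)

omit he₀ hd in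
/-- Along a red `e₀`: `some u` follows `some h` into any cluster of `G⁺` (through `w`). -/
lemma some_u_mem_of_some_h_mem (hred : ζ e₀ = true) {y : Option V}
    (hh : some h ∈ cluster (subdEnds ends e₀ h u l) (subdLift e₀ ζ d) y) :
    some u ∈ cluster (subdEnds ends e₀ h u l) (subdLift e₀ ζ d) y := by
  have h1 : (none : Option V) ∈ cluster (subdEnds ends e₀ h u l) (subdLift e₀ ζ d) y :=
    mem_cluster_of_edge (e := Sum.inl e₀) hh (by simpa using hred) (by simp)
  exact mem_cluster_of_edge (e := Sum.inr false) h1 (by simpa using hred) (by simp)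

omit he₀ hd in
/-- Along a red `e₀`: `some h` follows `some u` into any cluster of `G⁺` (through `w`). -/
lemma some_h_mem_of_some_u_mem (hred : ζ e₀ = true) {y : Option V}
    (hu : some u ∈ cluster (subdEnds ends e₀ h u l) (subdLift e₀ ζ d) y) :
    some h ∈ cluster (subdEnds ends e₀ h u l) (subdLift e₀ ζ d) y := by
  have h1 : (none : Option V) ∈ cluster (subdEnds ends e₀ h u l) (subdLift e₀ ζ d) y :=
    mem_cluster_of_edge (e := Sum.inr false) hu (by simpa using hred)
      (by rw [subdEnds_inr_false, Sym2.eq_swap])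
  exact mem_cluster_of_edge (e := Sum.inl e₀) h1 (by simpa using hred)
    (by rw [subdEnds_inl_self, Sym2.eq_swap])

omit hd in
/-- **The cluster transport, the other direction, vertices of `G`**: the image of the cluster of `x`
lies in the cluster of `some x`. -/
lemma some_mem_cluster_subdLift_of_mem {x v : V} (hv : v ∈ cluster ends ζ x) :
    some v ∈ cluster (subdEnds ends e₀ h u l) (subdLift e₀ ζ d) (some x) := by
  refine mem_of_conn_of_closed (ends := ends) (ω := ζ)
    (S := {v | some v ∈ cluster (subdEnds ends e₀ h u l) (subdLift e₀ ζ d) (some x)}) ?_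
    (mem_cluster_self _ _ _) hv
  intro p hp q hpq
  obtain ⟨_, e, he, hends⟩ := openGraph_adj.1 hpq
  have hred : ζ e = true := he
  by_cases hee : e = e₀
  · have hred₀ : ζ e₀ = true := hee ▸ hred
    rw [hee, he₀, Sym2.eq_iff] at hends
    simp only [Set.mem_setOf_eq] at hp ⊢
    rcases hends with ⟨h1, h2⟩ | ⟨h1, h2⟩
    · rw [← h1] at hp
      rw [← h2]
      exact some_u_mem_of_some_h_mem hred₀ hp
    · rw [← h2] at hp
      rw [← h1]
      exact some_h_mem_of_some_u_mem hred₀ hp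
  · refine mem_cluster_of_edge (e := Sum.inl e) hp (by simpa using hred) ?_
    rw [subdEnds_inl_of_ne hee, hends, Sym2.map_mk]

omit hd in
/-- **The cluster transport, the other direction, the new vertex**: `w` lies in the cluster of
`some x` under `subdWIn`. -/
lemma none_mem_cluster_subdLift_of {x : V} (hw : subdWIn ends e₀ h l ζ d x) :
    (none : Option V) ∈ cluster (subdEnds ends e₀ h u l) (subdLift e₀ ζ d) (some x) := by
  rcases hw with ⟨hred, hh⟩ | ⟨hdt, hl⟩
  · exact mem_cluster_of_edge (e := Sum.inl e₀) (some_mem_cluster_subdLift_of_mem he₀ hh)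
      (by simpa using hred) (by simp)
  · exact mem_cluster_of_edge (e := Sum.inr true) (some_mem_cluster_subdLift_of_mem he₀ hl)
      (by simpa using hdt) (by rw [subdEnds_inr_true, Sym2.eq_swap])

/-- **The cluster transport**: a vertex of `G` is in the cluster of `some x` in `G⁺` iff it is in the
cluster of `x` in `G`. -/
theorem some_mem_cluster_subdLift_iff {x v : V} :
    some v ∈ cluster (subdEnds ends e₀ h u l) (subdLift e₀ ζ d) (some x) ↔ v ∈ cluster ends ζ x := by
  constructor
  · intro hv
    rcases cluster_subdLift_subset he₀ hd x hv with ⟨v', hv', hvv'⟩ | ⟨hnone, _⟩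
    · rw [Option.some_injective _ hvv']; exact hv'
    · exact absurd hnone (by simp)
  · exact some_mem_cluster_subdLift_of_mem he₀

/-- **The cluster transport, the new vertex**: `w` is in the cluster of `some x` iff `subdWIn`. -/
theorem none_mem_cluster_subdLift_iff {x : V} :
    (none : Option V) ∈ cluster (subdEnds ends e₀ h u l) (subdLift e₀ ζ d) (some x) ↔
      subdWIn ends e₀ h l ζ d x := by
  constructor
  · intro hw
    rcases cluster_subdLift_subset he₀ hd x hw with ⟨v', _, hvv'⟩ | ⟨_, hw'⟩
    · exact absurd hvv' (by simp)
    · exact hw'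
  · exact none_mem_cluster_subdLift_of he₀

end Cluster

end LocRows

end Summit.Ventures.PercRepro2
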